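import Literature.MathematicalPhysics.QuantumFieldTheory.Balaban1983to89.LogChartProduct
import Literature.MathematicalPhysics.QuantumFieldTheory.Balaban1983to89.B13HaarSigmaJacobian
import Mathlib.LinearAlgebra.Determinant
import HarnessLib

/-!
# (JAC-Π) THE JACOBIAN OF THE PRODUCT EXPONENTIAL CHART IS BLOCK-DIAGONAL: `det jac_{𝔤^B}(X) = Π_b det jac_𝔤(X_b)`
# (the block-diagonality that makes `log jV` a SUM OF ONE-BOND TERMS — DET-REP's (JAC) row over this seat's (F4b′))

Crux `stmt-QuantumFields-20520` (`…Theses.UnitScaleTilt.FluctuationComparisonRegPrIntL`), LINE g18-1 S2β LAPLACE, row FOUR-POINT-DECAY ∕ DET-REP;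
cell `ym3-torus` (HUMAN RULING D-0037 — YM₃ on T³ is ladder rung R3, not the Clay problem), width seat `ym3-torus-px21` g11; count-neutral helper
(`--kind proof --supports stmt-QuantumFields-20520 --as helper`).  Theorems only: 0 `def`, 0 `instance`, 0 `notation`, 0 `sorry`.

WHY.  The local edition of the (C3β″) chart (✓`…S2BetaTubularChartDockLocal.exists_tubularHaarChart_pivotAct_local`, p747125) exports the free-bond density as
(F4b′) `jV y = σ₀ · |det jac_{𝔰𝔲(2)^{free}}(eV y)|` with the Jacobian endomorphism `jac` (lit `B13HaarSigmaJacobian.jac`, `jac X = g(ad_𝔤 X) = Σ (−ad X)ⁿ∕(n+1)!`)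
of the PRODUCT Lie algebra `𝔤^B = (piLogChart C B).lie`.  DET-REP's (JAC) row needs `log jV` as a SUM over the free bonds; this file supplies the missing
identity: `ad` of the sup-normed product algebra `𝔸^B` acts componentwise, hence so does every power series in it, so `jac_{𝔤^B}(X)` is, through the
componentwise linear equivalence `lieEquivPi : 𝔤^B ≃ₗ (B → 𝔤)`, the direct sum of the factor Jacobians `jac_𝔤(X_b)`, and its determinant is their product.
* `gSer_ad_pi_apply` — `g(ad X) Y` is componentwise on `𝔸^B`: `(g(ad X) Y)(b) = g(ad X(b)) (Y(b))` (the entire series of [Balaban1985Averaging] (33) pushed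
  through the continuous linear maps «apply to `Y`» and «evaluate at `b`», term by term `((ad X)ⁿ Y)(b) = (ad X(b))ⁿ (Y(b))`);
* `lieApply_jac` — `(jac_{𝔤^B} X Y)_b = jac_𝔤 (X_b) (Y_b)`;
* `jac_pi_eq_conj` — `jac_{𝔤^B} X = lieEquivPi⁻¹ ∘ (⊕_b jac_𝔤(X_b)) ∘ lieEquivPi` as linear maps;
* ★ `det_jac_pi` — `det jac_{𝔤^B}(X) = Π_b det jac_𝔤(X_b)` (Mathlib `LinearMap.det_conj`, `LinearMap.det_pi`); ★ `abs_det_jac_pi` — the same with absolute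
  values, the shape (F4b′) carries: so `jV y = σ₀ · Π_b |det jac_𝔤((eV y)_b)|` and `log jV y = log σ₀ + Σ_b log |det jac_𝔤((eV y)_b)|`.
HONEST SCOPE.  Linear algebra of an entire series on a product Banach algebra; nothing of Bałaban's analysis; (JAC)∕DET-REP∕LAPLACE∕S2β∕stmt-QuantumFields-20520
are NOT proved here; rung R3 = YM₃ on T³ — NOT d = 4, NOT infinite volume, NOT a mass gap, NOT Clay.
[cite: Helgason2000, Ch. I §1 Thm 1.14 (12)-(13) p.96; Balaban1985Averaging, (33) p.22; Balaban1985UV3, (18) p.260]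
-/

noncomputable section

open NormedSpace
open scoped Nat
open Literature.MathematicalPhysics.QuantumFieldTheory.Balaban1983to89
open Literature.MathematicalPhysics.QuantumFieldTheory.Balaban1983to89.LogChartProduct
open Literature.MathematicalPhysics.QuantumFieldTheory.Balaban1983to89.B13HaarSigmaJacobian
open Literature.Analysis.Calculus.ExpDifferential

namespace Summit.QuantumFields.YangMills.Theorems.FluctuationComparisonRegPrIntLS2BetaJacPi

/-! ## §1  `g(ad X)` is componentwise on the product algebra `𝔸^B` -/

section Ambient

variable (𝕂 : Type*) [RCLike 𝕂] {𝔸 : Type*} [NormedRing 𝔸] [NormedAlgebra 𝕂 𝔸] [CompleteSpace 𝔸]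
variable {B : Type*} [Fintype B]

omit [CompleteSpace 𝔸] in
/-- Powers of `ad` on the product algebra are componentwise: `((ad X)ⁿ Y)(b) = (ad X(b))ⁿ (Y(b))`. [cite: Balaban1985Averaging, (33) p.22 (bookkeeping)] -/
theorem ad_pi_pow_apply (X : B → 𝔸) (b : B) : ∀ (n : ℕ) (Y : B → 𝔸), ((ad 𝕂 X ^ n) Y) b = (ad 𝕂 (X b) ^ n) (Y b)
  | 0, Y => by simp
  | n + 1, Y => by
      rw [pow_succ, pow_succ, mul_apply_eq_comp, mul_apply_eq_comp, ad_apply, ad_apply, ad_pi_pow_apply X b n (X * Y - Y * X),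
        Pi.sub_apply, Pi.mul_apply, Pi.mul_apply]

/-- ★ **`g(ad X) Y` IS COMPONENTWISE ON `𝔸^B`**: `(g(ad X) Y)(b) = g(ad X(b)) (Y(b))` for the entire series `g(T) = Σ (−T)ⁿ∕(n+1)!` (lit `gSer`), summed in
the operator algebras of the sup-normed product `𝔸^B` and of `𝔸` respectively. [cite: Balaban1985Averaging, (33) p.22; Helgason2000, Ch. I §1 Thm 1.14 (12) p.96] -/
theorem gSer_ad_pi_apply (X Y : B → 𝔸) (b : B) : (gSer 𝕂 (ad 𝕂 X)) Y b = (gSer 𝕂 (ad 𝕂 (X b))) (Y b) := by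
  have h1 := ((hasSum_gSer (𝕂 := 𝕂) (ad 𝕂 X)).mapL (ContinuousLinearMap.apply 𝕂 (B → 𝔸) Y)).mapL
    (ContinuousLinearMap.proj b : (B → 𝔸) →L[𝕂] 𝔸)
  have h2 := (hasSum_gSer (𝕂 := 𝕂) (ad 𝕂 (X b))).mapL (ContinuousLinearMap.apply 𝕂 𝔸 (Y b))
  simp only [ContinuousLinearMap.apply_apply, ContinuousLinearMap.proj_apply] at h1 h2
  have h3 : (fun n : ℕ => (((((n + 1)! : 𝕂)⁻¹) • (-ad 𝕂 X) ^ n) Y) b) =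
      fun n : ℕ => ((((n + 1)! : 𝕂)⁻¹) • (-ad 𝕂 (X b)) ^ n) (Y b) := by
    funext n
    rw [← ad_neg, ← ad_neg, smul_apply, smul_apply, Pi.smul_apply,
      ad_pi_pow_apply 𝕂 (-X) b n Y, Pi.neg_apply]
  rw [h3] at h1
  exact h1.unique h2

end Ambient

/-! ## §2  `jac` of the product chart is the direct sum of the factor `jac`s; its determinant is the product -/

section Chart

variable {𝔸 : Type*} [NormedRing 𝔸] [NormedAlgebra ℂ 𝔸] [CompleteSpace 𝔸]
variable (C : LogChart 𝔸) [FiniteDimensional ℝ C.lie]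
  (hlie : ∀ x ∈ C.lie, ∀ y ∈ C.lie, x * y - y * x ∈ C.lie)
variable (B : Type*) [Fintype B] [FiniteDimensional ℝ (piLogChart C B).lie]

/-- ★ **`jac` OF THE PRODUCT CHART IS COMPONENTWISE**: `(jac_{𝔤^B} X Y)_b = jac_𝔤 (X_b) (Y_b)` (both sides are `g(ad ·)` of the ambient algebras by lit
✓`coe_jac_apply`, and `g(ad ·)` is componentwise, §1). [cite: Helgason2000, Ch. I §1 Thm 1.14 (12) p.96] -/
theorem lieApply_jac (X Y : (piLogChart C B).lie) (b : B) :
    lieApply C B (jac (lie_adStable_pi C B hlie) X Y) b = jac hlie (lieApply C B X b) (lieApply C B Y b) := by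
  apply Subtype.ext
  rw [coe_lieApply, coe_jac_apply, coe_jac_apply, coe_lieApply, coe_lieApply]
  exact gSer_ad_pi_apply ℝ (X : B → 𝔸) (Y : B → 𝔸) b

/-- **`jac_{𝔤^B} X` IS CONJUGATE, THROUGH `lieEquivPi`, TO THE DIRECT SUM `⊕_b jac_𝔤(X_b)`** (as linear endomorphisms of `𝔤^B`).
[cite: Helgason2000, Ch. I §1 Thm 1.14 (12) p.96] -/
theorem jac_pi_eq_conj (X : (piLogChart C B).lie) :
    (jac (lie_adStable_pi C B hlie) X : (piLogChart C B).lie →ₗ[ℝ] (piLogChart C B).lie) =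
      ((lieEquivPi C B).symm : (B → C.lie) →ₗ[ℝ] (piLogChart C B).lie) ∘ₗ
        (LinearMap.pi fun b : B => (jac hlie (lieApply C B X b) : C.lie →ₗ[ℝ] C.lie) ∘ₗ LinearMap.proj b) ∘ₗ
        (((lieEquivPi C B).symm).symm : (piLogChart C B).lie →ₗ[ℝ] (B → C.lie)) := by
  apply LinearMap.ext
  intro Y
  apply (lieEquivPi C B).injective
  funext b
  rw [LinearEquiv.symm_symm]
  simp only [LinearMap.coe_comp, Function.comp_apply, LinearEquiv.coe_coe, LinearEquiv.apply_symm_apply, LinearMap.pi_apply,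
    LinearMap.proj_apply, ContinuousLinearMap.coe_coe]
  exact lieApply_jac C hlie B X Y b

/-- ★★ **(JAC-Π) `det jac_{𝔤^B}(X) = Π_b det jac_𝔤(X_b)`** — the Jacobian determinant of the product exponential chart (the Haar density of `G^B` in
exponential coordinates, Helgason (13) for the product) is the product of the one-factor Jacobian determinants.  (Mathlib `LinearMap.det_conj` + `LinearMap.det_pi`.)
[cite: Helgason2000, Ch. I §1 Thm 1.14 (12)-(13) p.96; Balaban1985UV3, (18) p.260] -/
theorem det_jac_pi (X : (piLogChart C B).lie) :
    LinearMap.det (jac (lie_adStable_pi C B hlie) X : (piLogChart C B).lie →ₗ[ℝ] (piLogChart C B).lie) =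
      ∏ b : B, LinearMap.det (jac hlie (lieApply C B X b) : C.lie →ₗ[ℝ] C.lie) := by
  rw [jac_pi_eq_conj C hlie B X, LinearMap.det_conj, LinearMap.det_pi]

/-- ★★ **(JAC-Π), absolute values**: `|det jac_{𝔤^B}(X)| = Π_b |det jac_𝔤(X_b)|` — composed with (F4b′) `jV y = σ₀ · |det jac_{𝔤^B}(eV y)|` of
✓`…S2BetaTubularChartDockLocal`, the free-bond density is `σ₀ · Π_b |det jac_𝔤((eV y)_b)|` and `log jV` is a SUM of one-bond terms.
[cite: Helgason2000, Ch. I §1 Thm 1.14 (12)-(13) p.96; Balaban1985UV3, (18) p.260] -/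
theorem abs_det_jac_pi (X : (piLogChart C B).lie) :
    |LinearMap.det (jac (lie_adStable_pi C B hlie) X : (piLogChart C B).lie →ₗ[ℝ] (piLogChart C B).lie)| =
      ∏ b : B, |LinearMap.det (jac hlie (lieApply C B X b) : C.lie →ₗ[ℝ] C.lie)| := by
  rw [det_jac_pi C hlie B X, Finset.abs_prod]

end Chart

end Summit.QuantumFields.YangMills.Theorems.FluctuationComparisonRegPrIntLS2BetaJacPi

end
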